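import Literature.NumberTheory.CubicFields.DavenportBoundPos
import Literature.NumberTheory.CubicFields.UniformityFieldReduction
import Literature.NumberTheory.CubicFields.ThreeTorsionMeanDecomposition
import Literature.NumberTheory.QuadraticFields.ScholzReflection
import Literature.NumberTheory.QuadraticFields.ScholzReflectionArithmetic
import HarnessLib

/-!
# The mean of `#Cl₃` over fundamental discriminants is `O(X)`, from the dictionary and Davenport's bound

`Proofs` file (theorems only), topic `Literature/NumberTheory/CubicFields`, continuing
`UniformityFieldReduction.lean` (G1) and `DavenportBoundPos.lean` (Davenport's `O(X)` bound for orbits of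
positive discriminant, PROVED there): hypothesis (A) of `btt_uniformity_sqDvd_of_mean_of_perDisc` —
`Σ_{D ∈ negFundDiscrs Y} #Cl₃(D) ≤ C·Y` and `Σ_{D ∈ posFundDiscrs Y} #Cl₃(D) ≤ C·Y` — from

* Hasse's dictionary `#Cl₃(D) = 2·#{cubic fields of disc D} + 1` (the statement of the named fact
  `threeTorsion_eq_two_mul_cubicFieldCountOfDisc_add_one`, taken as a hypothesis), and
* for the NEGATIVE discriminants, Scholz's reflection theorem `#Cl₃(−d) ≤ 3·#Cl₃(D⁺)` (the named fact
  `Scholz1932_reflection`, taken as a hypothesis), which transfers the bound from the positive side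
  (`D⁺ = d/3` or `3d` is a positive fundamental discriminant `< 3Y`, or `1` when `d = 3`, and `d ↦ D⁺` is
  injective).

Main results: `mean_threeTorsion_pos_of_dictionary`, `mean_threeTorsion_neg_of_pos_of_scholz`,
`mean_threeTorsion_of_dictionary_of_scholz`.

## References

* K. Belabas, M. Bhargava, C. Pomerance, *Error estimates for the Davenport–Heilbronn theorems*, Duke Math.
  J. 153 (2010), Lemma 3.3 (proof, first display) [BelabasBhargavaPomerance2010].
* H. Davenport, *On the class-number of binary cubic forms I*, J. London Math. Soc. 26 (1951) [Davenport1951CubicFormsI].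
* L. C. Washington, *Introduction to Cyclotomic Fields*, Thm 10.10 (Scholz) [Washington1997].
-/

noncomputable section

namespace Literature.NumberTheory.CubicFields

open NumberField BinaryCubic RingOfForm Finset Literature.NumberTheory.QuadraticFields

/-! ### The positive side: dictionary + Davenport -/

/-- **`Σ_{D ∈ posFundDiscrs Y} #Cl₃(D) ≤ 4001·Y`** from the dictionary (hypothesis) and Davenport's bound
`ncard_gl2zOrbits_pos_le` (proved): `#Cl₃(D) = 2·N₃(D) + 1`, `Σ_D N₃(D) ≤ #{orbits of irreducible forms,
0 < Disc < Y} ≤ 2000·Y`. [cite: BelabasBhargavaPomerance2010, Lemma 3.3 (proof, first display)] -/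
theorem mean_threeTorsion_pos_of_dictionary
    (hdict : ∀ D : ℤ, ((D % 4 = 1 ∧ Squarefree D ∧ D ≠ 1) ∨
      (4 ∣ D ∧ (D / 4 % 4 = 2 ∨ D / 4 % 4 = 3) ∧ Squarefree (D / 4))) →
      quadFieldThreeTorsion D = 2 * cubicFieldCountOfDisc D + 1) (Y : ℕ) :
    (∑ D ∈ posFundDiscrs Y, (quadFieldThreeTorsion D : ℝ)) ≤ 4001 * Y := by
  classical
  set T : Finset ℤ := posFundDiscrs Y with hTdef
  set Sd : ℤ → Set (Set (BinaryCubic ℤ)) := fun d =>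
    {O | ∃ f : BinaryCubic ℤ, O = gl2zOrbit f ∧ f.IsIrreducible ∧ IsMaximal f ∧ f.disc = d} with hSd
  set B : Set (Set (BinaryCubic ℤ)) :=
    {O | ∃ f : BinaryCubic ℤ, O = gl2zOrbit f ∧ f.IsIrreducible ∧ 0 < f.disc ∧ f.disc < Y} with hBdef
  have hT : ∀ D ∈ T, (0 < D ∧ D < Y) ∧ ((D % 4 = 1 ∧ Squarefree D ∧ D ≠ 1) ∨
      (4 ∣ D ∧ (D / 4 % 4 = 2 ∨ D / 4 % 4 = 3) ∧ Squarefree (D / 4))) := fun D hD =>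
    mem_posFundDiscrs.mp hD
  have hT0 : ∀ D ∈ T, D ≠ 0 := fun D hD => (hT D hD).1.1.ne'
  have hBfin : B.Finite := by
    refine (Set.Finite.biUnion (Finset.Ioo (0 : ℤ) Y).finite_toSet fun D hD =>
      orbitsOfDisc_finite (Finset.mem_Ioo.mp hD).1.ne').subset ?_
    rintro O ⟨f, rfl, -, h0, hY⟩
    exact Set.mem_biUnion (Finset.mem_coe.mpr (Finset.mem_Ioo.mpr ⟨h0, hY⟩)) ⟨f, rfl, rfl⟩
  have hsum : ∑ D ∈ T, (cubicFieldCountOfDisc D : ℝ) ≤ 2000 * Y := by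
    have h1 : ∑ D ∈ T, cubicFieldCountOfDisc D = (⋃ D ∈ T, Sd D).ncard := by
      rw [ncard_biUnion_eq_sum_of_disjoint T Sd (fun D hD => irredMaximalOrbitsOfDisc_finite (hT0 D hD)) ?_]
      · exact Finset.sum_congr rfl fun D _ => (ncard_irredMaximalOrbitsOfDisc D).symm
      · intro i _ j _ hij
        refine (disjoint_orbitsOfDisc hij).mono ?_ ?_
        · rintro O ⟨f, hO, -, -, hd⟩
          exact ⟨f, hO, hd⟩
        · rintro O ⟨f, hO, -, -, hd⟩
          exact ⟨f, hO, hd⟩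
    have h2 : (⋃ D ∈ T, Sd D) ⊆ B := by
      intro O hO
      obtain ⟨D, hD, hOD⟩ := Set.mem_iUnion₂.mp hO
      obtain ⟨f, rfl, hirr, -, hd⟩ := hOD
      exact ⟨f, rfl, hirr, by rw [hd]; exact (hT D hD).1.1, by rw [hd]; exact (hT D hD).1.2⟩
    calc ∑ D ∈ T, (cubicFieldCountOfDisc D : ℝ) = ((∑ D ∈ T, cubicFieldCountOfDisc D : ℕ) : ℝ) := by
          push_cast; rfl
      _ = (((⋃ D ∈ T, Sd D).ncard : ℕ) : ℝ) := by rw [h1]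
      _ ≤ (B.ncard : ℝ) := by exact_mod_cast Set.ncard_le_ncard h2 hBfin
      _ ≤ 2000 * Y := ncard_gl2zOrbits_pos_le Y
  have hcard : (T.card : ℝ) ≤ Y := by
    have : T.card ≤ Y :=
      calc T.card ≤ (Finset.Ioo (0 : ℤ) Y).card := Finset.card_le_card (Finset.filter_subset _ _)
        _ ≤ Y := by rw [Int.card_Ioo]; omega
    exact_mod_cast this
  calc ∑ D ∈ T, (quadFieldThreeTorsion D : ℝ) = ∑ D ∈ T, (2 * (cubicFieldCountOfDisc D : ℝ) + 1) :=
        Finset.sum_congr rfl fun D hD => by rw [hdict D (hT D hD).2]; push_cast; ring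
    _ = 2 * ∑ D ∈ T, (cubicFieldCountOfDisc D : ℝ) + T.card := by
        rw [Finset.sum_add_distrib, ← Finset.mul_sum, Finset.sum_const, nsmul_eq_mul, mul_one]
    _ ≤ 2 * (2000 * Y) + Y := by linarith
    _ = 4001 * Y := by ring

/-! ### The negative side via Scholz's reflection theorem -/

/-- A fundamental discriminant is not divisible by `9`. [folklore] -/
theorem not_nine_dvd_of_isFundamental {D : ℤ}
    (hD : (D % 4 = 1 ∧ Squarefree D ∧ D ≠ 1) ∨
      (4 ∣ D ∧ (D / 4 % 4 = 2 ∨ D / 4 % 4 = 3) ∧ Squarefree (D / 4))) : ¬ (9 : ℤ) ∣ D := by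
  intro h9
  rcases hD with ⟨-, hsq, -⟩ | ⟨h4, -, hsq⟩
  · have := hsq 3 (by simpa [show (3 : ℤ) * 3 = 9 by norm_num] using h9)
    exact absurd (Int.isUnit_iff.mp this) (by norm_num)
  · obtain ⟨m, hm⟩ := h4
    have hm' : D / 4 = m := by rw [hm]; simp
    rw [hm'] at hsq
    have h9m : (9 : ℤ) ∣ m := by
      have hcop : IsCoprime (9 : ℤ) 4 := ⟨1, -2, by norm_num⟩
      exact hcop.dvd_of_dvd_mul_left (hm ▸ h9)
    have := hsq 3 (by simpa [show (3 : ℤ) * 3 = 9 by norm_num] using h9m)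
    exact absurd (Int.isUnit_iff.mp this) (by norm_num)

/-- **`Σ_{D ∈ negFundDiscrs Y} #Cl₃(D) ≤ (3 + 12C)·Y` from `Σ_{D ∈ posFundDiscrs Y'} #Cl₃(D) ≤ C·Y'` and
Scholz's reflection theorem** (hypothesis `Scholz1932_reflection`): `#Cl₃(−d) ≤ 3·#Cl₃(D⁺)` with
`D⁺ ∈ posFundDiscrs (3Y) ∪ {1}` (`isFundamental_mirrorDisc`) and `d ↦ D⁺` injective. [cite: Washington1997, Thm 10.10] -/
theorem mean_threeTorsion_neg_of_pos_of_scholz (hS : Scholz1932_reflection) {C : ℝ} (hC : 0 ≤ C)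
    (hpos : ∀ Y : ℕ, (∑ D ∈ posFundDiscrs Y, (quadFieldThreeTorsion D : ℝ)) ≤ C * Y) (Y : ℕ) :
    (∑ D ∈ negFundDiscrs Y, (quadFieldThreeTorsion D : ℝ)) ≤ (3 + 12 * C) * Y := by
  classical
  rcases Nat.eq_zero_or_pos Y with hY0 | hYpos
  · subst hY0
    have h0 : ∀ D ∈ negFundDiscrs 0, False := fun D hD => by
      have := (mem_negFundDiscrs.mp hD).1; omega
    rw [Finset.sum_eq_zero fun D hD => (h0 D hD).elim]; simp
  have hY1 : (1 : ℝ) ≤ Y := by exact_mod_cast hYpos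
  -- the mirror map
  set m : ℤ → ℤ := fun D => if 3 ∣ D.natAbs then ((D.natAbs / 3 : ℕ) : ℤ) else 3 * (D.natAbs : ℤ) with hm
  have hneg : ∀ D ∈ negFundDiscrs Y, D = -((D.natAbs : ℕ) : ℤ) ∧ 0 < D.natAbs ∧ D.natAbs < Y ∧
      (((-((D.natAbs : ℕ) : ℤ)) % 4 = 1 ∧ Squarefree (-((D.natAbs : ℕ) : ℤ)) ∧ (-((D.natAbs : ℕ) : ℤ)) ≠ 1) ∨
        (4 ∣ (-((D.natAbs : ℕ) : ℤ)) ∧ ((-((D.natAbs : ℕ) : ℤ)) / 4 % 4 = 2 ∨ (-((D.natAbs : ℕ) : ℤ)) / 4 % 4 = 3) ∧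
          Squarefree ((-((D.natAbs : ℕ) : ℤ)) / 4))) := by
    intro D hD
    obtain ⟨⟨h1, h2⟩, hf⟩ := mem_negFundDiscrs.mp hD
    have hDeq : D = -((D.natAbs : ℕ) : ℤ) := by omega
    refine ⟨hDeq, by omega, by omega, ?_⟩
    rw [← hDeq]; exact hf
  -- pointwise Scholz
  have hpt : ∀ D ∈ negFundDiscrs Y, (quadFieldThreeTorsion D : ℝ) ≤ 3 * (quadFieldThreeTorsion (m D) : ℝ) := by
    intro D hD
    obtain ⟨hDeq, -, -, hf⟩ := hneg D hD
    have h := hS.right hf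
    rw [← hDeq] at h
    have : (quadFieldThreeTorsion D : ℝ) ≤ ((3 * quadFieldThreeTorsion
        (if 3 ∣ D.natAbs then ((D.natAbs / 3 : ℕ) : ℤ) else 3 * (D.natAbs : ℤ)) : ℕ) : ℝ) := by
      exact_mod_cast h
    simpa [hm] using this
  -- the image of the mirror map
  have himg : ∀ D ∈ negFundDiscrs Y, m D ∈ insert (1 : ℤ) (posFundDiscrs (3 * Y)) := by
    intro D hD
    obtain ⟨hDeq, hd0, hdY, hf⟩ := hneg D hD
    rw [Finset.mem_insert]
    by_cases hd3 : D.natAbs = 3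
    · left; simp only [hm, hd3]; norm_num
    · right
      have hfund := isFundamental_mirrorDisc hf hd3
      rw [mem_posFundDiscrs]
      refine ⟨⟨?_, ?_⟩, by simpa only [hm] using hfund⟩
      · simp only [hm]
        split_ifs with h3 <;> omega
      · simp only [hm]
        split_ifs with h3 <;> omega
  -- injectivity of the mirror map on negative fundamental discriminants
  have hinj : Set.InjOn m ↑(negFundDiscrs Y) := by
    intro D₁ hD₁ D₂ hD₂ h
    obtain ⟨hD₁eq, -, -, hf₁⟩ := hneg D₁ hD₁
    obtain ⟨hD₂eq, -, -, hf₂⟩ := hneg D₂ hD₂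
    have h9₁ := not_nine_dvd_of_isFundamental hf₁
    have h9₂ := not_nine_dvd_of_isFundamental hf₂
    simp only [hm] at h
    split_ifs at h with h₁ h₂ h₂
    · have : D₁.natAbs = D₂.natAbs := by
        have := Nat.div_mul_cancel h₁
        have := Nat.div_mul_cancel h₂
        have h' : D₁.natAbs / 3 = D₂.natAbs / 3 := by exact_mod_cast h
        omega
      omega
    · exfalso
      have h' : ((D₁.natAbs / 3 : ℕ) : ℤ) = 3 * (D₂.natAbs : ℤ) := h
      have : D₁.natAbs = 9 * D₂.natAbs := by
        have := Nat.div_mul_cancel h₁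
        have h'' : D₁.natAbs / 3 = 3 * D₂.natAbs := by exact_mod_cast h'
        omega
      exact h9₁ ⟨-(D₂.natAbs : ℤ), by omega⟩
    · exfalso
      have h' : 3 * (D₁.natAbs : ℤ) = ((D₂.natAbs / 3 : ℕ) : ℤ) := h
      have : D₂.natAbs = 9 * D₁.natAbs := by
        have := Nat.div_mul_cancel h₂
        have h'' : 3 * D₁.natAbs = D₂.natAbs / 3 := by exact_mod_cast h'
        omega
      exact h9₂ ⟨-(D₁.natAbs : ℤ), by omega⟩
    · have : D₁.natAbs = D₂.natAbs := by exact_mod_cast (mul_left_cancel₀ (by norm_num : (3:ℤ) ≠ 0) h)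
      omega
  have ht0 : ∀ E : ℤ, (0 : ℝ) ≤ (quadFieldThreeTorsion E : ℝ) := fun E => by positivity
  calc ∑ D ∈ negFundDiscrs Y, (quadFieldThreeTorsion D : ℝ)
      ≤ ∑ D ∈ negFundDiscrs Y, 3 * (quadFieldThreeTorsion (m D) : ℝ) := Finset.sum_le_sum hpt
    _ = 3 * ∑ E ∈ (negFundDiscrs Y).image m, (quadFieldThreeTorsion E : ℝ) := by
        rw [Finset.mul_sum, Finset.sum_image hinj]
    _ ≤ 3 * ∑ E ∈ insert (1 : ℤ) (posFundDiscrs (3 * Y)), (quadFieldThreeTorsion E : ℝ) := by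
        have hsub : (negFundDiscrs Y).image m ⊆ insert (1 : ℤ) (posFundDiscrs (3 * Y)) := by
          intro E hE
          obtain ⟨D, hD, rfl⟩ := Finset.mem_image.mp hE
          exact himg D hD
        exact mul_le_mul_of_nonneg_left (Finset.sum_le_sum_of_subset_of_nonneg hsub fun E _ _ => ht0 E)
          (by norm_num)
    _ = 3 * ((quadFieldThreeTorsion 1 : ℝ) + ∑ E ∈ posFundDiscrs (3 * Y), (quadFieldThreeTorsion E : ℝ)) := by
        have h1 : (1 : ℤ) ∉ posFundDiscrs (3 * Y) := by
          rw [mem_posFundDiscrs]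
          rintro ⟨-, ⟨-, -, h⟩ | ⟨h4, -, -⟩⟩
          · exact h rfl
          · norm_num at h4
        rw [Finset.sum_insert h1]
    _ ≤ 3 * (1 + C * ((3 * Y : ℕ) : ℝ)) := by
        have h1 : (quadFieldThreeTorsion 1 : ℝ) = 1 := by rw [quadFieldThreeTorsion_one]; simp
        have h2 := hpos (3 * Y)
        rw [h1]; linarith
    _ ≤ (3 + 12 * C) * Y := by
        push_cast
        nlinarith [mul_nonneg hC (by positivity : (0 : ℝ) ≤ Y)]

/-- **Hypothesis (A) of `btt_uniformity_sqDvd_of_mean_of_perDisc` from the dictionary and Scholz's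
reflection theorem** (Davenport's bound being proved): `Σ_{D ∈ negFundDiscrs Y} #Cl₃(D) ≤ C·Y` and
`Σ_{D ∈ posFundDiscrs Y} #Cl₃(D) ≤ C·Y`. [cite: BelabasBhargavaPomerance2010, Lemma 3.3 (proof, first display)] -/
theorem mean_threeTorsion_of_dictionary_of_scholz
    (hdict : ∀ D : ℤ, ((D % 4 = 1 ∧ Squarefree D ∧ D ≠ 1) ∨
      (4 ∣ D ∧ (D / 4 % 4 = 2 ∨ D / 4 % 4 = 3) ∧ Squarefree (D / 4))) →
      quadFieldThreeTorsion D = 2 * cubicFieldCountOfDisc D + 1)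
    (hS : Scholz1932_reflection) :
    ∃ C : ℝ, ∀ Y : ℕ, (∑ D ∈ negFundDiscrs Y, (quadFieldThreeTorsion D : ℝ)) ≤ C * Y ∧
      (∑ D ∈ posFundDiscrs Y, (quadFieldThreeTorsion D : ℝ)) ≤ C * Y := by
  refine ⟨3 + 12 * 4001, fun Y => ⟨?_, ?_⟩⟩
  · exact mean_threeTorsion_neg_of_pos_of_scholz hS (by norm_num) (mean_threeTorsion_pos_of_dictionary hdict) Y
  · have := mean_threeTorsion_pos_of_dictionary hdict Y
    have hY : (0 : ℝ) ≤ Y := by positivity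
    nlinarith

/-- The same, with the dictionary supplied by the tree's named fact
`threeTorsion_eq_two_mul_cubicFieldCountOfDisc_add_one`. [cite: BelabasBhargavaPomerance2010, Lemma 3.3] -/
theorem mean_threeTorsion_of_facts (hdict : threeTorsion_eq_two_mul_cubicFieldCountOfDisc_add_one)
    (hS : Scholz1932_reflection) :
    ∃ C : ℝ, ∀ Y : ℕ, (∑ D ∈ negFundDiscrs Y, (quadFieldThreeTorsion D : ℝ)) ≤ C * Y ∧
      (∑ D ∈ posFundDiscrs Y, (quadFieldThreeTorsion D : ℝ)) ≤ C * Y :=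
  mean_threeTorsion_of_dictionary_of_scholz hdict hS

end Literature.NumberTheory.CubicFields

end
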